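import Summits.NavierStokesRegularity.FluidComputer.TubeTableFat18
import HarnessLib

/-!
# Kernel run of the fat restart tube, chunks 18 … 23 (bp3 gen 15)

HONEST FRAMING: low prior, high value-of-information experiment on Tao's machine paradigm; NOT a
claim that NS blows up.

Kernel evaluations (`decide +kernel`; no `native_decide`, no extra axioms) of the in-tree tube checker
`runTube` (`P = 60`, 12 Taylor terms, cube `Rt`, read-out `CLt`) on the chunks `cF 18 … cF 23` of
`TubeTableFat18.lean`, each from the recorded boundary state `sF i` to `sF (i+1)`.

[cite: Tao2016AveragedNS, §5.5 Thm 5.3 (5.5)]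
-/

namespace Summit.NavierStokesRegularity.FluidComputer

namespace TubeTableFat18

open Literature.Analysis.FluidPDE.FluidComputer Literature.Analysis.FluidPDE.FluidComputer.TubeTable
open Literature.Analysis.FluidPDE.FluidComputer.ThresholdLevelTable (GIt)

set_option maxHeartbeats 10000000 in
set_option maxRecDepth 200000 in
/-- Chunk 18 of the fat tube run (steps 900 … 949, `h = 2^-11`). [folklore] -/
theorem runF_18 : runTube 60 12 GIt CLt Rt (sF 18) (cF 18) = some (sF (18 + 1)) := by
  decide +kernel

set_option maxHeartbeats 10000000 in
set_option maxRecDepth 200000 in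
/-- Chunk 19 of the fat tube run (steps 950 … 999, `h = 2^-11`). [folklore] -/
theorem runF_19 : runTube 60 12 GIt CLt Rt (sF 19) (cF 19) = some (sF (19 + 1)) := by
  decide +kernel

set_option maxHeartbeats 10000000 in
set_option maxRecDepth 200000 in
/-- Chunk 20 of the fat tube run (steps 1000 … 1049, `h = 2^-11`). [folklore] -/
theorem runF_20 : runTube 60 12 GIt CLt Rt (sF 20) (cF 20) = some (sF (20 + 1)) := by
  decide +kernel

set_option maxHeartbeats 10000000 in
set_option maxRecDepth 200000 in
/-- Chunk 21 of the fat tube run (steps 1050 … 1099, `h = 2^-11`). [folklore] -/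
theorem runF_21 : runTube 60 12 GIt CLt Rt (sF 21) (cF 21) = some (sF (21 + 1)) := by
  decide +kernel

set_option maxHeartbeats 10000000 in
set_option maxRecDepth 200000 in
/-- Chunk 22 of the fat tube run (steps 1100 … 1149, `h = 2^-11`). [folklore] -/
theorem runF_22 : runTube 60 12 GIt CLt Rt (sF 22) (cF 22) = some (sF (22 + 1)) := by
  decide +kernel

set_option maxHeartbeats 10000000 in
set_option maxRecDepth 200000 in
/-- Chunk 23 of the fat tube run (steps 1150 … 1199, `h = 2^-11`). [folklore] -/
theorem runF_23 : runTube 60 12 GIt CLt Rt (sF 23) (cF 23) = some (sF (23 + 1)) := by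
  decide +kernel

end TubeTableFat18

end Summit.NavierStokesRegularity.FluidComputer
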